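import Summits.CriticalPhenomena.PercolationContinuityZ3.Theorems.PercNearOneGluingNoHeavyConstsClusterSquareClusterSeparated
import HarnessLib

/-!
# No double clash unless a cluster of `a` is doubly linked to `{b, c}`: the exact combinatorial content of NDC

builds on p205010 (kernel theorem, internal audit signed; external expert review pending)

PAPER-2 track "percolation constants", part (ii), seat `prim-consts-1`, gen 17 (lane index
`run/shared/lean/prim/consts/CONSTANTS.md`, row A19; memo `FROM-prim-consts-1-g17-THREE-COPY-STRUCTURE.md` §2b).
Support file for the crux `NoHeavyLowerTail` (stmt-CriticalPhenomena-4575; `--supports`).  Theorems only; no sorries.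

The no-double-clash hypothesis of `…ConstsClusterSquareNDCPos.lean` is, unravelled, a DOUBLE-LINKAGE condition on the graph `H` of
positive pairs: a double clash at the cluster `K = C_a(ω)` with clash vertices `y ≠ y'` (outside `K ∪ {a, b, c}`, each with a neighbour
in `K`) provides, in `H − K`, two vertex-disjoint walks `y → b` (inside `C_b(ω)`) and `y' → c` (inside `C_c(ω)`), AND two vertex-disjoint
walks `y → c` (inside `C_c(η')`) and `y' → b` (inside `C_b(η')`).  Hence (`Consts.not_doubleClash_of_unlinked`) **NDC holds as soon as, for
every `H`-connected `K ∋ a` avoiding `b, c` and all such `y ≠ y'`, either every pair of walks `y → b`, `y' → c` in `H − K` meets, or every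
pair of walks `y → c`, `y' → b` in `H − K` meets** — and conversely such a pair of linkages is exactly what a double clash is, so this is
the combinatorial content of NDC (the converse is not formalised).  The decidable criteria of `…ClusterSquareThin / Separated /
ClusterSeparated / Linked / Multilinked` and the pendant contractions are sufficient conditions for this hypothesis.  CSQ, DUU at
`(a; b, c)` and TS for `{a, b, c}` follow (`Consts.clusterSquare_le_sq_of_unlinked`, `Consts.sq_real_split_le_of_unlinked`,
`Consts.tripleSplit_of_unlinked`).
Reference: N. Gladkov, arXiv:2408.08457v2 (2024), Thm. 4.3, Def. 4.2, Lemma 3.1, Example 2.5, Thm. 5.2.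
-/

noncomputable section

open Classical

namespace Summit.CriticalPhenomena.PercolationContinuityZ3.Theorems

open MeasureTheory Finset Literature.Probability.LatticeModels Literature.Probability.Percolation
open Literature.Probability.Percolation.DecisionTree Literature.Probability.Percolation.BHK2006
open Literature.Probability.Percolation.TargetExploration Literature.Probability.Percolation.ClusterConditioning

namespace Consts

section General

variable {V : Type*}

/-- **No double clash unless some cluster of `a` is doubly linked to `{b, c}`.**  `H` carries the positive pairs.  Suppose that for
every `K ∋ a` with `b, c ∉ K`, `H`-connected from `a` (every `T ∋ a` closed under `H`-steps into `K` contains `K`), and all `y ≠ y'`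
outside `K ∪ {a, b, c}` with neighbours in `K`: every walk `y → b` meets every walk `y' → c` in `H − K`, or every walk `y → c` meets
every walk `y' → b` in `H − K`.  Then the no-double-clash hypothesis of `Consts.clusterSquare_le_sq_of_noDoubleClash_pos` holds.
[folklore; input for Gladkov2024, Thm. 4.3] -/
theorem not_doubleClash_of_unlinked (H : SimpleGraph V) (w : Sym2 V → unitInterval) {a b c : V}
    (hH : ∀ u v, u ≠ v → (0 : ℝ) < w s(u, v) → H.Adj u v)
    (hK : ∀ (K : Set V) (y y' : V), a ∈ K → b ∉ K → c ∉ K →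
      (∀ T : Set V, a ∈ T → (∀ u x, u ∈ T → H.Adj u x → x ∈ K → x ∈ T) → K ⊆ T) →
      y ∉ K → y' ∉ K → (∃ k, k ∈ K ∧ H.Adj k y) → (∃ k, k ∈ K ∧ H.Adj k y') →
      y ≠ a → y ≠ b → y ≠ c → y' ≠ a → y' ≠ b → y' ≠ c → y ≠ y' →
      (∀ (P₁ : H.Walk y b) (P₂ : H.Walk y' c), (∀ x ∈ P₁.support, x ∉ K) → (∀ x ∈ P₂.support, x ∉ K) →
          ∃ x, x ∈ P₁.support ∧ x ∈ P₂.support) ∨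
      (∀ (Q₁ : H.Walk y c) (Q₂ : H.Walk y' b), (∀ x ∈ Q₁.support, x ∉ K) → (∀ x ∈ Q₂.support, x ∉ K) →
          ∃ x, x ∈ Q₁.support ∧ x ∈ Q₂.support))
    {ω η : Set (Sym2 V)} (hω : ∀ e ∈ ω, (0 : ℝ) < w e) (hη : ∀ e ∈ η, (0 : ℝ) < w e)
    (hab : ¬ (openGraph ω).Reachable a b) (hac : ¬ (openGraph ω).Reachable a c) (hbc : ¬ (openGraph ω).Reachable b c)
    (hbc' : ¬ (openGraph (η \ barOf {a} (setCl ω {a}))).Reachable b c) :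
    ¬ ((∃ y k : V, (openGraph ω).Reachable a k ∧ (0 : ℝ) < w s(k, y) ∧ (openGraph ω).Reachable b y ∧
          (openGraph (η \ barOf {a} (setCl ω {a}))).Reachable c y) ∧
       (∃ y k : V, (openGraph ω).Reachable a k ∧ (0 : ℝ) < w s(k, y) ∧ (openGraph ω).Reachable c y ∧
          (openGraph (η \ barOf {a} (setCl ω {a}))).Reachable b y)) := by
  rintro ⟨⟨y, k, hk, hw, hby, hcy⟩, ⟨y', k', hk', hw', hcy', hby'⟩⟩
  set θ := η \ barOf {a} (setCl ω {a}) with hθdef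
  set K : Set V := {x | (openGraph ω).Reachable a x} with hKdef
  have hadjH : ∀ (ξ : Set (Sym2 V)), (∀ e ∈ ξ, (0 : ℝ) < w e) → openGraph ξ ≤ H := by
    intro ξ hξ u v huv
    rw [openGraph_adj] at huv
    exact hH u v huv.2 (hξ _ huv.1)
  have hθ : ∀ e ∈ θ, (0 : ℝ) < w e := fun e he => hη e he.1
  have hθK : ∀ u v, (openGraph θ).Adj u v → ¬ (openGraph ω).Reachable a v := by
    intro u v huv hav
    rw [openGraph_adj, hθdef, barOf_setCl_singleton_eq_cutSet] at huv
    exact huv.1.2 ⟨v, Sym2.mem_mk_right u v, hav⟩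
  have hky : H.Adj k y := hH k y (fun h => hab (hk.trans (h ▸ hby.symm))) hw
  have hky' : H.Adj k' y' := hH k' y' (fun h => hac (hk'.trans (h ▸ hcy'.symm))) hw'
  have hyK : y ∉ K := fun h => hab (h.trans hby.symm)
  have hyK' : y' ∉ K := fun h => hac (h.trans hcy'.symm)
  have hconn : ∀ T : Set V, a ∈ T → (∀ u x, u ∈ T → H.Adj u x → x ∈ K → x ∈ T) → K ⊆ T := by
    intro T haT hT x hx
    obtain ⟨X⟩ := id hx
    exact mem_of_openWalk_adm H T (fun z => z ∈ K) (fun u z hu huz hz => hT u z hu huz hz) (hadjH ω hω) X haT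
      fun z hz => Or.inr (show (openGraph ω).Reachable a z from ⟨X.takeUntil z hz⟩)
  -- the four walks
  obtain ⟨P₁⟩ := hby.symm   -- ω: y → b
  obtain ⟨P₂⟩ := hcy'.symm  -- ω: y' → c
  obtain ⟨Q₁⟩ := hcy.symm   -- θ: y → c
  obtain ⟨Q₂⟩ := hby'.symm  -- θ: y' → b
  have hP₁ : ∀ x ∈ P₁.support, (openGraph ω).Reachable b x := fun x hx => hby.trans ⟨P₁.takeUntil x hx⟩
  have hP₂ : ∀ x ∈ P₂.support, (openGraph ω).Reachable c x := fun x hx => hcy'.trans ⟨P₂.takeUntil x hx⟩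
  have hQ₁ : ∀ x ∈ Q₁.support, (openGraph θ).Reachable c x := fun x hx => hcy.trans ⟨Q₁.takeUntil x hx⟩
  have hQ₂ : ∀ x ∈ Q₂.support, (openGraph θ).Reachable b x := fun x hx => hby'.trans ⟨Q₂.takeUntil x hx⟩
  have hQ₁K : ∀ x ∈ Q₁.support, x ∉ K := not_reachable_of_mem_support a hθK Q₁ hyK
  have hQ₂K : ∀ x ∈ Q₂.support, x ∉ K := not_reachable_of_mem_support a hθK Q₂ hyK'
  rcases hK K y y' (SimpleGraph.Reachable.refl a) hab hac hconn hyK hyK' ⟨k, hk, hky⟩ ⟨k', hk', hky'⟩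
      (fun h => hyK (by rw [h]; exact SimpleGraph.Reachable.refl a)) (fun h => hbc' (by rw [← h]; exact hcy.symm))
      (fun h => hbc (by rw [← h]; exact hby)) (fun h => hyK' (by rw [h]; exact SimpleGraph.Reachable.refl a))
      (fun h => hbc (by rw [← h]; exact hcy'.symm)) (fun h => hbc' (by rw [← h]; exact hby'))
      (fun h => hbc (hby.trans (by rw [h]; exact hcy'.symm))) with hlink | hlink
  · have e₁ := SimpleGraph.Walk.support_mapLe_eq_support (hadjH ω hω) P₁
    have e₂ := SimpleGraph.Walk.support_mapLe_eq_support (hadjH ω hω) P₂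
    obtain ⟨x, hx₁, hx₂⟩ := hlink (P₁.mapLe (hadjH ω hω)) (P₂.mapLe (hadjH ω hω))
      (fun x hx => fun hxK => hab (hxK.trans (hP₁ x (by rwa [e₁] at hx)).symm))
      (fun x hx => fun hxK => hac (hxK.trans (hP₂ x (by rwa [e₂] at hx)).symm))
    rw [e₁] at hx₁; rw [e₂] at hx₂
    exact hbc ((hP₁ x hx₁).trans (hP₂ x hx₂).symm)
  · have e₁ := SimpleGraph.Walk.support_mapLe_eq_support (hadjH _ hθ) Q₁
    have e₂ := SimpleGraph.Walk.support_mapLe_eq_support (hadjH _ hθ) Q₂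
    obtain ⟨x, hx₁, hx₂⟩ := hlink (Q₁.mapLe (hadjH _ hθ)) (Q₂.mapLe (hadjH _ hθ))
      (fun x hx => hQ₁K x (by rwa [e₁] at hx)) (fun x hx => hQ₂K x (by rwa [e₂] at hx))
    rw [e₁] at hx₁; rw [e₂] at hx₂
    exact hbc' ((hQ₂ x hx₂).trans (hQ₁ x hx₁).symm)

end General

/-! ### `Fin n` forms -/

section Fin

variable {n : ℕ} (w : Sym2 (Fin n) → unitInterval) (a b c : Fin n) (H : SimpleGraph (Fin n))

/-- **CSQ at `(a; b, c)` unless some cluster of `a` is doubly linked to `{b, c}`** (hypotheses as in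
`Consts.not_doubleClash_of_unlinked`): `clusterSquare w a b c ≤ μ(b ↮ c)²`. [cite: Gladkov2024, Thm. 4.3, Def. 4.2, Lemma 3.1, Ex. 2.5] -/
theorem clusterSquare_le_sq_of_unlinked (hH : ∀ u v, u ≠ v → (0 : ℝ) < w s(u, v) → H.Adj u v)
    (hK : ∀ (K : Set (Fin n)) (y y' : Fin n), a ∈ K → b ∉ K → c ∉ K →
      (∀ T : Set (Fin n), a ∈ T → (∀ u x, u ∈ T → H.Adj u x → x ∈ K → x ∈ T) → K ⊆ T) →
      y ∉ K → y' ∉ K → (∃ k, k ∈ K ∧ H.Adj k y) → (∃ k, k ∈ K ∧ H.Adj k y') →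
      y ≠ a → y ≠ b → y ≠ c → y' ≠ a → y' ≠ b → y' ≠ c → y ≠ y' →
      (∀ (P₁ : H.Walk y b) (P₂ : H.Walk y' c), (∀ x ∈ P₁.support, x ∉ K) → (∀ x ∈ P₂.support, x ∉ K) →
          ∃ x, x ∈ P₁.support ∧ x ∈ P₂.support) ∨
      (∀ (Q₁ : H.Walk y c) (Q₂ : H.Walk y' b), (∀ x ∈ Q₁.support, x ∉ K) → (∀ x ∈ Q₂.support, x ∉ K) →
          ∃ x, x ∈ Q₁.support ∧ x ∈ Q₂.support)) :
    clusterSquare w a b c ≤ (prodBernoulli w).real (openConn b c)ᶜ ^ 2 :=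
  clusterSquare_le_sq_of_noDoubleClash_pos w a b c fun _ _ hω hη hab hac hbc hbc' =>
    not_doubleClash_of_unlinked H w hH hK hω hη hab hac hbc hbc'

/-- **DUU at `(a; b, c)` unless some cluster of `a` is doubly linked to `{b, c}`.** [cite: Gladkov2024, Thm. 5.2 and Thm. 4.3] -/
theorem sq_real_split_le_of_unlinked (hH : ∀ u v, u ≠ v → (0 : ℝ) < w s(u, v) → H.Adj u v)
    (hK : ∀ (K : Set (Fin n)) (y y' : Fin n), a ∈ K → b ∉ K → c ∉ K →
      (∀ T : Set (Fin n), a ∈ T → (∀ u x, u ∈ T → H.Adj u x → x ∈ K → x ∈ T) → K ⊆ T) →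
      y ∉ K → y' ∉ K → (∃ k, k ∈ K ∧ H.Adj k y) → (∃ k, k ∈ K ∧ H.Adj k y') →
      y ≠ a → y ≠ b → y ≠ c → y' ≠ a → y' ≠ b → y' ≠ c → y ≠ y' →
      (∀ (P₁ : H.Walk y b) (P₂ : H.Walk y' c), (∀ x ∈ P₁.support, x ∉ K) → (∀ x ∈ P₂.support, x ∉ K) →
          ∃ x, x ∈ P₁.support ∧ x ∈ P₂.support) ∨
      (∀ (Q₁ : H.Walk y c) (Q₂ : H.Walk y' b), (∀ x ∈ Q₁.support, x ∉ K) → (∀ x ∈ Q₂.support, x ∉ K) →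
          ∃ x, x ∈ Q₁.support ∧ x ∈ Q₂.support)) :
    (prodBernoulli w).real ((openConn a b)ᶜ ∩ (openConn a c)ᶜ ∩ (openConn b c)ᶜ) ^ 2 ≤
      (prodBernoulli w).real ((openConn a b)ᶜ ∩ (openConn a c)ᶜ) * (prodBernoulli w).real (openConn b c)ᶜ ^ 2 :=
  sq_real_split_le_of_noDoubleClash_pos w a b c fun _ _ hω hη hab hac hbc hbc' =>
    not_doubleClash_of_unlinked H w hH hK hω hη hab hac hbc hbc'

/-- **TS for `{a, b, c}` unless some cluster of `a` is doubly linked to `{b, c}`** (root `a`):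
`μ(a ↮ b, a ↮ c, b ↮ c)² ≤ μ(a ↮ b) μ(a ↮ c) μ(b ↮ c)`. [cite: Gladkov2024, Thm. 5.2, Cor. 5.3 (pattern) and Thm. 4.3] -/
theorem tripleSplit_of_unlinked (hH : ∀ u v, u ≠ v → (0 : ℝ) < w s(u, v) → H.Adj u v)
    (hK : ∀ (K : Set (Fin n)) (y y' : Fin n), a ∈ K → b ∉ K → c ∉ K →
      (∀ T : Set (Fin n), a ∈ T → (∀ u x, u ∈ T → H.Adj u x → x ∈ K → x ∈ T) → K ⊆ T) →
      y ∉ K → y' ∉ K → (∃ k, k ∈ K ∧ H.Adj k y) → (∃ k, k ∈ K ∧ H.Adj k y') →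
      y ≠ a → y ≠ b → y ≠ c → y' ≠ a → y' ≠ b → y' ≠ c → y ≠ y' →
      (∀ (P₁ : H.Walk y b) (P₂ : H.Walk y' c), (∀ x ∈ P₁.support, x ∉ K) → (∀ x ∈ P₂.support, x ∉ K) →
          ∃ x, x ∈ P₁.support ∧ x ∈ P₂.support) ∨
      (∀ (Q₁ : H.Walk y c) (Q₂ : H.Walk y' b), (∀ x ∈ Q₁.support, x ∉ K) → (∀ x ∈ Q₂.support, x ∉ K) →
          ∃ x, x ∈ Q₁.support ∧ x ∈ Q₂.support)) :
    (prodBernoulli w).real ((openConn a b)ᶜ ∩ (openConn a c)ᶜ ∩ (openConn b c)ᶜ) ^ 2 ≤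
      (prodBernoulli w).real (openConn a b)ᶜ * (prodBernoulli w).real (openConn a c)ᶜ *
        (prodBernoulli w).real (openConn b c)ᶜ :=
  tripleSplit_of_noDoubleClash_pos w a b c fun _ _ hω hη hab hac hbc hbc' =>
    not_doubleClash_of_unlinked H w hH hK hω hη hab hac hbc hbc'

end Fin

end Consts

end Summit.CriticalPhenomena.PercolationContinuityZ3.Theorems
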